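import Summits.HodgeConjecture.HodgeConjecture.Theorems.R90S4TypeTwoCornerField              -- FILE 2a (this seat): `exists_corner_dichotomy_of_typeTwo`, `hermStar_sub'` (brings the `Gqs` frame of ★ p863813 and the quadratic local norm group)
import HarnessLib

/-!
# R90-TF · S4 «Ch. 13.1–2», (DICT) sub-brick (2), FILE 2b — THE TYPE-(2) NORM-CLASS COVER: for a regular `γ ∈ U(Φ₃)(L⁺_v)` whose Cartan algebra splits as `Z(γ) = L_w·e ⊕ (1−e)Z(γ)`
# (line ⊕ field) along a `⋆`-fixed idempotent `e`, the `⋆`-fixed units of `Z(γ)` fall into the FOUR classes `{1, r₀·1, k₀, r₀·k₀}` modulo `⋆`-norms (Rogawski 1990, §3.6 pp. 28–29)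

Cell `hodgecm-mathlib`, crux H413 (`stmt-HodgeConjecture-24833`, lane `--supports … --as helper`), route of record `HCCMUnconditional` (no route verbs; count-neutral).
Programme R90-TF, section S4, dealer K2E2-plan (g7): deal «(DICT)(2) `K¹ × E¹`» (`R90/STATUS.md` 2026-09-05T00:55:10Z), GO F1 01:12:40Z («(A2) is NOT a hypothesis»); seat K2E3-p27 (g3).
Supplies the hypotheses `hr₀σ hr₀n hcov hg₀ hg₀n` (with `k₀`) of ★ FILE 1 `R90S4StableConjTwoClassesOfNormClassesFour.exists_unitary_conj_or_of_normClasses_four` from the TYPE-(2)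
LETTER on the Cartan algebra.  THEOREMS ONLY — no `def`, no instance, no notation, no `sorry`; ★-only imports.

## THE MATHEMATICS
`v` non-split, `⋆ = hermStar (c ⊗ 1) Φ₃`, `γ ∈ Gqs L v` regular, `Z = Z(γ)`.  TYPE-(2) LETTER: `e ∈ Z`, `e² = e = e⋆`, `e ≠ 0, 1`, LINE corner `Z·e = L_w·e` and FIELD corner (every
non-zero element of `(1−e)Z` is invertible in it) [§3.6: `Z ≅ E_w × L₄`].  FILE 2a gives `c ∈ Z` (`⋆`-fixed, a corner-unit, killed by no corner-norm) with «every `⋆`-fixed corner-unit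
`s` has `(1−e)s(β⋆β) ∈ {(1−e), (1−e)c}`»; ★ `exists_conjLocal_eq_not_exists_norm` ∕ `exists_norm_mul_of_not_exists_norm` give `r₀ ∈ F_v^× ∖ N(L_w^×)` with `F_v^× = N ⊔ r₀N`.  Put
`k₀ := e + (1−e)c`.  A `⋆`-fixed unit `x ∈ Z` is `x = λe + (1−e)x` with `σλ = λ ≠ 0`; writing `λ·σ(α)α ∈ {1, r₀}` (line class) and `(1−e)·(ρ⁻¹x)·(β⋆β) ∈ {(1−e), (1−e)c}` for
`ρ ∈ {1, r₀}` the line class (corner class of `ρ⁻¹x`), the element `t := αe + (1−e)β ∈ Z` is invertible and `x·(t⋆t) ∈ {1, r₀·1, k₀, r₀·k₀}` — the class of `r₀` in the corner is never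
needed (the arithmetic question (A2) «`F_v^× ⊆ N_{L₄∕K}`» does not enter).  `k₀` is killed by no `⋆`-norm from `Z` (read in the corner) and neither is `r₀k₀` (read on the line: `r₀` would be
a norm): **`exists_normClasses_cover_of_typeTwo`** [§3.6: `|H¹(F, T_K × E¹)| = 4`, `|𝔇(T∕F)| = 2`].

## CONTENTS
* §1 **`exists_normClasses_cover_of_typeTwo`**.

HONEST LABEL: HC_CM is proved only modulo the 7 printed citations (2 remaining named inputs: hLiu418 = stmt-HodgeConjecture-24832, h413 = stmt-HodgeConjecture-24833) until rung 0
closes.  Local algebra toward the (DICT) payer of (B2-S); discharges no named input; (W-NP) ∕ (B2-S) OPEN.  REL ≠ ★ ≠ BUILT.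

## References
* [Rogawski1990] J. D. Rogawski, *Automorphic Representations of Unitary Groups in Three Variables*, Ann. of Math. Stud. 123 (1990), §3.5 Prop. 3.5.2 pp. 25–26, §3.6 pp. 28–29.
* [Serre1979] J.-P. Serre, *Local Fields*, GTM 67 (1979), Ch. XIV §2 (local norm index).
-/

set_option autoImplicit false
set_option linter.dupNamespace false

noncomputable section

open NumberField IsDedekindDomain
open scoped Matrix MatrixGroups
open Literature.NumberTheory.Rogawski1990 Literature.NumberTheory.Automorphic Literature.NumberTheory.Automorphic.UnitaryGroup
open Literature.AlgebraicGeometry.ShimuraVarieties (unitaryGroup mem_unitaryGroup_iff)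
open Summit.HodgeConjecture.HodgeConjecture.Cruxes.H413

namespace Summit.HodgeConjecture.HodgeConjecture.R90.S4

section TypeTwo

variable (L : Type) [Field L] [NumberField L] [IsCMField L] (v : HeightOneSpectrum (𝓞 ↥(maximalRealSubfield L)))

variable {L v} in
/-- **THE TYPE-(2) NORM-CLASS COVER.**  `v` non-split; `γ ∈ Gqs L v` regular with Cartan algebra `Z = Z(γ)`; TYPE-(2) LETTER: `e ∈ Z` with `e² = e = e⋆`, `e ≠ 0, 1`, LINE corner
`∀ x ∈ Z, x·e ∈ (L ⊗ L⁺_v)·e`, FIELD corner `∀ x ∈ Z, (1−e)x ≠ 0 → ∃ y ∈ Z, (1−e)xy = 1−e`.  Then there are a `σ`-fixed non-norm scalar `r₀` and a `⋆`-fixed unit `k₀ ∈ Z` with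
`k₀·e = e` such that neither `k₀` nor `r₀·k₀` is killed by a `⋆`-norm from `Z` and every `⋆`-fixed unit `x ∈ Z` satisfies `x·(t⋆t) ∈ {1, r₀·1, k₀, r₀·k₀}` for an invertible `t ∈ Z` —
the hypotheses `hr₀σ hr₀n hcov hg₀ hg₀n` of ★ `exists_unitary_conj_or_of_normClasses_four` at `σ := c ⊗ 1`, `H := Φ₃ ⊗ 1` («`|H¹(F, T_K × E¹)| = |F^×∕N_E|·|K^×∕N_{KE∕K}| = 4`», with
no use of the class of `r₀` in `K^×∕N`). [cite: Rogawski1990, §3.5 Prop. 3.5.2 pp. 25–26; §3.6 pp. 28–29] [cite: Serre1979, Ch. XIV §2] -/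
theorem exists_normClasses_cover_of_typeTwo (hns : ∀ w : PlacesOver L v, IsCMField.complexConj L • w.1 = w.1) {γ : Gqs L v}
    (hreg : IsRegularElt (γ.val : GL (Fin 3) (LocalRing L v)))
    {e : Matrix (Fin 3) (Fin 3) (LocalRing L v)} (heZ : e ∈ cartanAlgebra (γ.val.val : Matrix (Fin 3) (Fin 3) (LocalRing L v))) (hee : e * e = e)
    (hes : hermStar (conjLocal L (IsCMField.complexConj L) v) (cmLocalForm L 3 v) e = e) (he0 : e ≠ 0) (he1 : e ≠ 1)
    (hline : ∀ x ∈ cartanAlgebra (γ.val.val : Matrix (Fin 3) (Fin 3) (LocalRing L v)), ∃ a : LocalRing L v, x * e = a • e)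
    (hcorner : ∀ x ∈ cartanAlgebra (γ.val.val : Matrix (Fin 3) (Fin 3) (LocalRing L v)), (1 - e) * x ≠ 0 → ∃ y ∈ cartanAlgebra (γ.val.val : Matrix (Fin 3) (Fin 3) (LocalRing L v)), (1 - e) * (x * y) = 1 - e) :
    ∃ (r₀ : LocalRing L v) (k₀ : Matrix (Fin 3) (Fin 3) (LocalRing L v)),
      conjLocal L (IsCMField.complexConj L) v r₀ = r₀ ∧ (∀ z : LocalRing L v, z * conjLocal L (IsCMField.complexConj L) v z ≠ r₀) ∧
      k₀ ∈ cartanAlgebra (γ.val.val : Matrix (Fin 3) (Fin 3) (LocalRing L v)) ∧ hermStar (conjLocal L (IsCMField.complexConj L) v) (cmLocalForm L 3 v) k₀ = k₀ ∧ IsUnit k₀.det ∧ k₀ * e = e ∧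
      (¬ ∃ t : GL (Fin 3) (LocalRing L v), t.val ∈ cartanAlgebra (γ.val.val : Matrix (Fin 3) (Fin 3) (LocalRing L v)) ∧
        k₀ * (hermStar (conjLocal L (IsCMField.complexConj L) v) (cmLocalForm L 3 v) t.val * t.val) = 1) ∧
      (¬ ∃ t : GL (Fin 3) (LocalRing L v), t.val ∈ cartanAlgebra (γ.val.val : Matrix (Fin 3) (Fin 3) (LocalRing L v)) ∧
        (r₀ • k₀) * (hermStar (conjLocal L (IsCMField.complexConj L) v) (cmLocalForm L 3 v) t.val * t.val) = 1) ∧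
      ∀ x : Matrix (Fin 3) (Fin 3) (LocalRing L v), x ∈ cartanAlgebra (γ.val.val : Matrix (Fin 3) (Fin 3) (LocalRing L v)) → hermStar (conjLocal L (IsCMField.complexConj L) v) (cmLocalForm L 3 v) x = x → IsUnit x.det →
        ∃ t : GL (Fin 3) (LocalRing L v), t.val ∈ cartanAlgebra (γ.val.val : Matrix (Fin 3) (Fin 3) (LocalRing L v)) ∧
          (x * (hermStar (conjLocal L (IsCMField.complexConj L) v) (cmLocalForm L 3 v) t.val * t.val) = 1 ∨
           x * (hermStar (conjLocal L (IsCMField.complexConj L) v) (cmLocalForm L 3 v) t.val * t.val) = r₀ • (1 : Matrix (Fin 3) (Fin 3) (LocalRing L v)) ∨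
           x * (hermStar (conjLocal L (IsCMField.complexConj L) v) (cmLocalForm L 3 v) t.val * t.val) = k₀ ∨
           x * (hermStar (conjLocal L (IsCMField.complexConj L) v) (cmLocalForm L 3 v) t.val * t.val) = r₀ • k₀) := by
  classical
  obtain ⟨w⟩ := (inferInstance : Nonempty (PlacesOver L v))
  have hw := hns w
  have hF : IsField (LocalRing L v) := LocalRing.isField_of_smul_eq (IsCMField.complexConj L) (IsCMField.complexConj_ne_one L) w hw
  have hunit : ∀ a : LocalRing L v, a ≠ 0 → IsUnit a := by
    intro a ha
    obtain ⟨b, hb⟩ := hF.mul_inv_cancel ha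
    exact IsUnit.of_mul_eq_one b hb
  -- ### the corner field (FILE 2a): `c`, its corner inverse `ci`, «not killed», and the two corner classes
  obtain ⟨c, hcZ, hcs, ⟨ci, hciZ, hcci⟩, hnkc, hdichZ⟩ := exists_corner_dichotomy_of_typeTwo hns hreg heZ hee hes he1 hcorner
  -- ### notation and the letters of the quasi-split local form
  set σ : LocalRing L v →+* LocalRing L v := conjLocal L (IsCMField.complexConj L) v with hσ_def
  set Hm : Matrix (Fin 3) (Fin 3) (LocalRing L v) := cmLocalForm L 3 v with hHm_def
  set γm : Matrix (Fin 3) (Fin 3) (LocalRing L v) := γ.val.val with hγm_def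
  set Z := cartanAlgebra γm with hZ_def
  have hH : IsUnit Hm.det := by
    rw [hHm_def, cmLocalForm_eq_over]
    exact (Matrix.isUnit_iff_isUnit_det _).1 ((StdForm.antidiagonal 3).isUnit_over _)
  have hσσ : ∀ r : LocalRing L v, σ (σ r) = r := Literature.NumberTheory.Weil1982.UnitaryFinTopForm.conjLocal_conjLocal L v
  have hγU : (γ.val : GL (Fin 3) (LocalRing L v)) ∈ unitaryGroup σ Hm := γ.2
  have hsep : γm.charpoly.Separable := hreg
  have hcomm : ∀ a b : Matrix (Fin 3) (Fin 3) (LocalRing L v), a ∈ Z → b ∈ Z → a * b = b * a := by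
    letI : Field (LocalRing L v) := hF.toField
    intro a b ha hb
    exact mul_comm_of_mem_cartanAlgebra hsep ha hb
  have hstar : ∀ a : Matrix (Fin 3) (Fin 3) (LocalRing L v), a ∈ Z → hermStar σ Hm a ∈ Z := fun a ha => hermStar_mem_cartanAlgebra σ Hm hH hγU ha
  -- ### `F_v^× = N ⊔ r₀·N`
  obtain ⟨δ, hcδ, hδ⟩ := Literature.NumberTheory.Weil1982.UnitaryFinTopForm.exists_complexConj_eq_neg_ne_zero L
  obtain ⟨r₀, hr₀σ, hr₀u, hr₀n⟩ := exists_conjLocal_eq_not_exists_norm L v (IsCMField.complexConj L) hcδ hδ w hw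
  have hr₀n' : ∀ z : LocalRing L v, z * σ z ≠ r₀ := by
    intro z hz
    refine hr₀n ⟨z, ?_, by rw [← hz, mul_comm]⟩
    rw [← hz] at hr₀u
    exact isUnit_of_mul_isUnit_left hr₀u
  obtain ⟨ur, hur⟩ := id hr₀u
  have hr₀r₁ : r₀ * (↑ur⁻¹ : LocalRing L v) = 1 := by rw [← hur, Units.mul_inv]
  have hur₁ : IsUnit (↑ur⁻¹ : LocalRing L v) := ⟨ur⁻¹, rfl⟩
  have hσr₁ : σ ↑ur⁻¹ = ↑ur⁻¹ := by
    have h : σ ↑ur⁻¹ * r₀ = 1 := by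
      conv_lhs => rw [← hr₀σ]
      rw [← RingHom.map_mul, mul_comm, hr₀r₁, RingHom.map_one]
    calc σ ↑ur⁻¹ = σ ↑ur⁻¹ * (r₀ * ↑ur⁻¹) := by rw [hr₀r₁, mul_one]
      _ = ↑ur⁻¹ := by rw [← mul_assoc, h, one_mul]
  -- ### block calculus along `e`
  have h1e : (1 - e) * e = 0 := by rw [Matrix.sub_mul, Matrix.one_mul, hee, sub_self]
  have he1e : e * (1 - e) = 0 := by rw [Matrix.mul_sub, Matrix.mul_one, hee, sub_self]
  have h1e1e : (1 - e) * (1 - e) = 1 - e := by rw [Matrix.mul_sub, Matrix.mul_one, h1e, sub_zero]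
  have h1eZ : (1 - e) ∈ Z := Subalgebra.sub_mem _ (Subalgebra.one_mem _) heZ
  have h1e0 : (1 : Matrix (Fin 3) (Fin 3) (LocalRing L v)) - e ≠ 0 := sub_ne_zero.2 (Ne.symm he1)
  have h1es : hermStar σ Hm (1 - e) = 1 - e := by rw [hermStar_sub', hermStar_one σ Hm hH, hes]
  have hdec : ∀ x ∈ Z, ∀ a : LocalRing L v, x * e = a • e → x = a • e + (1 - e) * x := by
    intro x hx a hxe
    calc x = x * e + x * (1 - e) := by rw [Matrix.mul_sub, Matrix.mul_one, add_sub_cancel]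
      _ = a • e + (1 - e) * x := by rw [hxe, hcomm _ _ hx h1eZ]
  have hprod : ∀ (a b : LocalRing L v) (x y : Matrix (Fin 3) (Fin 3) (LocalRing L v)), x ∈ Z → y ∈ Z → (a • e + (1 - e) * x) * (b • e + (1 - e) * y) = (a * b) • e + (1 - e) * (x * y) := by
    intro a b x y hx hy
    have hxe : x * (1 - e) = (1 - e) * x := hcomm _ _ hx h1eZ
    have hxe' : x * e = e * x := hcomm _ _ hx heZ
    have T1 : (a • e) * (b • e) = (a * b) • e := by rw [Matrix.smul_mul, Matrix.mul_smul, smul_smul, hee]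
    have T2 : (a • e) * ((1 - e) * y) = 0 := by rw [Matrix.smul_mul, ← Matrix.mul_assoc, he1e, Matrix.zero_mul, smul_zero]
    have T3 : ((1 - e) * x) * (b • e) = 0 := by
      rw [Matrix.mul_smul, Matrix.mul_assoc, hxe', ← Matrix.mul_assoc, h1e, Matrix.zero_mul, smul_zero]
    have T4 : ((1 - e) * x) * ((1 - e) * y) = (1 - e) * (x * y) := by
      rw [Matrix.mul_assoc (1 - e) x, ← Matrix.mul_assoc x (1 - e) y, hxe, Matrix.mul_assoc (1 - e) x y, ← Matrix.mul_assoc (1 - e) (1 - e), h1e1e]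
    rw [Matrix.add_mul, Matrix.mul_add, Matrix.mul_add, T1, T2, T3, T4, add_zero, zero_add]
  have hstarDec : ∀ (a : LocalRing L v) (x : Matrix (Fin 3) (Fin 3) (LocalRing L v)), x ∈ Z → hermStar σ Hm (a • e + (1 - e) * x) = σ a • e + (1 - e) * hermStar σ Hm x := by
    intro a x hx
    rw [hermStar_add, hermStar_smul, hes, hermStar_mul σ Hm hH, h1es, hcomm _ _ (hstar _ hx) h1eZ]
  -- ### `k₀ := e + (1−e)·c`
  let k₀ : Matrix (Fin 3) (Fin 3) (LocalRing L v) := (1 : LocalRing L v) • e + (1 - e) * c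
  have hk₀_def : k₀ = (1 : LocalRing L v) • e + (1 - e) * c := rfl
  have hk₀Z : k₀ ∈ Z := Subalgebra.add_mem _ (Subalgebra.smul_mem _ heZ _) (Subalgebra.mul_mem _ h1eZ hcZ)
  have hk₀s : hermStar σ Hm k₀ = k₀ := by rw [hk₀_def, hstarDec _ _ hcZ, RingHom.map_one, hcs]
  have hk₀e : k₀ * e = e := by
    rw [hk₀_def, Matrix.add_mul, Matrix.smul_mul, hee, one_smul, Matrix.mul_assoc, hcomm _ _ hcZ heZ, ← Matrix.mul_assoc, h1e, Matrix.zero_mul, add_zero]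
  have h1ek₀ : (1 - e) * k₀ = (1 - e) * c := by
    rw [hk₀_def, Matrix.mul_add, Matrix.mul_smul, h1e, smul_zero, zero_add, ← Matrix.mul_assoc, h1e1e]
  have hk₀u : IsUnit k₀.det := by
    refine Matrix.isUnit_det_of_right_inverse (B := (1 : LocalRing L v) • e + (1 - e) * ci) ?_
    rw [hk₀_def, hprod 1 1 c ci hcZ hciZ, one_mul, one_smul, hcci, add_sub_cancel]
  -- ### `k₀` is not killed by a `⋆`-norm from `Z` (read in the corner field)
  have hnk1 : ¬ ∃ t : GL (Fin 3) (LocalRing L v), t.val ∈ Z ∧ k₀ * (hermStar σ Hm t.val * t.val) = 1 := by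
    rintro ⟨t, htZ, hk⟩
    have htiZ : (t⁻¹).val ∈ Z := mem_cartanAlgebra_iff.2 (mem_cartanAlgebra_iff.1 htZ).units_inv_left
    refine hnkc t.val htZ ⟨(t⁻¹).val, htiZ, by rw [Units.mul_inv, Matrix.mul_one]⟩ ?_
    calc (1 - e) * (c * (hermStar σ Hm t.val * t.val)) = (1 - e) * k₀ * (hermStar σ Hm t.val * t.val) := by rw [h1ek₀, Matrix.mul_assoc]
      _ = 1 - e := by rw [Matrix.mul_assoc, hk, Matrix.mul_one]
  -- ### `r₀·k₀` is not killed by a `⋆`-norm from `Z` (read on the line: `r₀` would be a norm)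
  have hnk2 : ¬ ∃ t : GL (Fin 3) (LocalRing L v), t.val ∈ Z ∧ (r₀ • k₀) * (hermStar σ Hm t.val * t.val) = 1 := by
    rintro ⟨t, htZ, hk⟩
    obtain ⟨μ, hte⟩ := hline t.val htZ
    have htse : hermStar σ Hm t.val * e = σ μ • e := by
      have h := congrArg (hermStar σ Hm) hte
      rw [hermStar_mul σ Hm hH, hes, hermStar_smul, hes] at h
      rw [hcomm _ _ (hstar _ htZ) heZ]
      exact h
    have h1 : (r₀ • k₀) * (hermStar σ Hm t.val * t.val) * e = (μ * σ μ * r₀) • e := by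
      rw [Matrix.mul_assoc, Matrix.mul_assoc, hte, Matrix.mul_smul, htse, smul_smul, Matrix.mul_smul, Matrix.smul_mul, hk₀e, smul_smul]
    rw [hk, Matrix.one_mul] at h1
    have h2 : μ * σ μ * r₀ = 1 := by
      have h' : (μ * σ μ * r₀ - 1) • e = 0 := by rw [sub_smul, one_smul, ← h1, sub_self]
      by_contra hne
      exact he0 (((hunit _ (sub_ne_zero.2 hne)).smul_eq_zero).1 h')
    refine hr₀n ⟨σ μ * r₀, IsUnit.of_mul_eq_one μ (by rw [mul_comm, ← mul_assoc]; exact h2), ?_⟩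
    rw [RingHom.map_mul, hσσ, hr₀σ]
    linear_combination (-r₀) * h2
  -- ### THE COVER
  refine ⟨r₀, k₀, hr₀σ, hr₀n', hk₀Z, hk₀s, hk₀u, hk₀e, hnk1, hnk2, ?_⟩
  intro x hx hxs hxu
  obtain ⟨lx, hxe⟩ := hline x hx
  have hxdec : x = lx • e + (1 - e) * x := hdec x hx lx hxe
  obtain ⟨ux, hux⟩ := (Matrix.isUnit_iff_isUnit_det x).2 hxu
  -- the line coordinate `lx` is a `σ`-fixed unit
  have hlxσ : σ lx = lx := by
    have h := congrArg (hermStar σ Hm) hxe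
    rw [hermStar_mul σ Hm hH, hes, hxs, hermStar_smul, hes, hcomm _ _ heZ hx, hxe] at h
    have h' : (σ lx - lx) • e = 0 := by rw [sub_smul, ← h, sub_self]
    by_contra hne
    exact he0 (((hunit _ (sub_ne_zero.2 hne)).smul_eq_zero).1 h')
  have hlx0 : lx ≠ 0 := by
    rintro rfl
    apply he0
    calc e = (ux⁻¹).val * (ux.val * e) := by rw [← Matrix.mul_assoc, Units.inv_mul, Matrix.one_mul]
      _ = 0 := by rw [hux, hxe, zero_smul, Matrix.mul_zero]
  have hlxu : IsUnit lx := hunit lx hlx0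
  -- the corner coordinate of `x` is a `⋆`-fixed corner-unit
  have hxI : (1 - e) * x ≠ 0 := by
    intro h0
    apply h1e0
    have hx' : x * (1 - e) = 0 := by rw [hcomm _ _ hx h1eZ]; exact h0
    calc (1 : Matrix (Fin 3) (Fin 3) (LocalRing L v)) - e = (ux⁻¹).val * (ux.val * (1 - e)) := by rw [← Matrix.mul_assoc, Units.inv_mul, Matrix.one_mul]
      _ = 0 := by rw [hux, hx', Matrix.mul_zero]
  -- assembling `t = α·e + (1−e)·β` from a line datum `α` (inverse `α'`) and a corner datum `β` (corner inverse `β'`)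
  have hassemble : ∀ (α α' ρℓ : LocalRing L v) (β β' ρc : Matrix (Fin 3) (Fin 3) (LocalRing L v)), β ∈ Z → β' ∈ Z → α * α' = 1 → lx * (σ α * α) = ρℓ →
      (1 - e) * (β * β') = 1 - e → (1 - e) * (x * (hermStar σ Hm β * β)) = (1 - e) * ρc →
      ∃ t : GL (Fin 3) (LocalRing L v), t.val ∈ Z ∧ x * (hermStar σ Hm t.val * t.val) = ρℓ • e + (1 - e) * ρc := by
    intro α α' ρℓ β β' ρc hβZ hβ'Z hαα' hα hββ' hρ
    have htZ : α • e + (1 - e) * β ∈ Z := Subalgebra.add_mem _ (Subalgebra.smul_mem _ heZ _) (Subalgebra.mul_mem _ h1eZ hβZ)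
    have ht'Z : α' • e + (1 - e) * β' ∈ Z := Subalgebra.add_mem _ (Subalgebra.smul_mem _ heZ _) (Subalgebra.mul_mem _ h1eZ hβ'Z)
    have htt' : (α • e + (1 - e) * β) * (α' • e + (1 - e) * β') = 1 := by
      rw [hprod α α' β β' hβZ hβ'Z, hαα', one_smul, hββ', add_sub_cancel]
    have ht't : (α' • e + (1 - e) * β') * (α • e + (1 - e) * β) = 1 := by
      rw [hcomm _ _ ht'Z htZ]
      exact htt'
    refine ⟨⟨_, _, htt', ht't⟩, htZ, ?_⟩
    change x * (hermStar σ Hm (α • e + (1 - e) * β) * (α • e + (1 - e) * β)) = _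
    rw [hstarDec α β hβZ, hprod (σ α) α _ _ (hstar _ hβZ) hβZ]
    calc x * ((σ α * α) • e + (1 - e) * (hermStar σ Hm β * β))
        = (lx • e + (1 - e) * x) * ((σ α * α) • e + (1 - e) * (hermStar σ Hm β * β)) := by rw [← hxdec]
      _ = (lx * (σ α * α)) • e + (1 - e) * (x * (hermStar σ Hm β * β)) := hprod lx (σ α * α) x _ hx (Subalgebra.mul_mem _ (hstar _ hβZ) hβZ)
      _ = ρℓ • e + (1 - e) * ρc := by rw [hα, hρ]
  by_cases hlxN : ∃ z : LocalRing L v, IsUnit z ∧ lx = σ z * z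
  · -- line class `1`: corner classes of `x` itself
    obtain ⟨zF, ⟨uF, huF⟩, hlxz⟩ := hlxN
    have hzα : zF * (↑uF⁻¹ : LocalRing L v) = 1 := by rw [← huF, Units.mul_inv]
    have hαz : (↑uF⁻¹ : LocalRing L v) * zF = 1 := by rw [← huF, Units.inv_mul]
    have hα : lx * (σ ↑uF⁻¹ * ↑uF⁻¹) = 1 := by
      rw [hlxz, mul_mul_mul_comm, ← RingHom.map_mul σ, hzα, RingHom.map_one, one_mul]
    have hxs' : (1 - e) * hermStar σ Hm x = (1 - e) * x := by rw [hxs]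
    obtain ⟨β, hβZ, β', hβ'Z, hββ', hρ⟩ := hdichZ x hx hxs' hxI
    rcases hρ with hρ | hρ
    · -- `x ~ 1`
      obtain ⟨t, htZ, hxt⟩ := hassemble _ zF 1 β β' 1 hβZ hβ'Z hαz hα hββ' (by rw [hρ, Matrix.mul_one])
      refine ⟨t, htZ, Or.inl ?_⟩
      rw [hxt, one_smul, Matrix.mul_one, add_sub_cancel]
    · -- `x ~ k₀`
      obtain ⟨t, htZ, hxt⟩ := hassemble _ zF 1 β β' c hβZ hβ'Z hαz hα hββ' hρ
      exact ⟨t, htZ, Or.inr (Or.inr (Or.inl (hxt.trans hk₀_def.symm)))⟩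
  · -- line class `r₀`: corner classes of `r₀⁻¹·x`
    obtain ⟨zF, ⟨uF, huF⟩, hlxz⟩ := exists_norm_mul_of_not_exists_norm L v (IsCMField.complexConj L) hcδ hδ w hw hr₀σ hr₀u hlxσ hlxu hr₀n hlxN
    have hzα : zF * (↑uF⁻¹ : LocalRing L v) = 1 := by rw [← huF, Units.mul_inv]
    have hαz : (↑uF⁻¹ : LocalRing L v) * zF = 1 := by rw [← huF, Units.inv_mul]
    have hα : lx * (σ ↑uF⁻¹ * ↑uF⁻¹) = r₀ := by
      rw [hlxz, mul_assoc (σ zF * zF) r₀, mul_comm r₀, ← mul_assoc (σ zF * zF), mul_mul_mul_comm, ← RingHom.map_mul σ, hzα, RingHom.map_one, one_mul, one_mul]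
    have hsZ : (↑ur⁻¹ : LocalRing L v) • x ∈ Z := Subalgebra.smul_mem _ hx _
    have hss : (1 - e) * hermStar σ Hm ((↑ur⁻¹ : LocalRing L v) • x) = (1 - e) * ((↑ur⁻¹ : LocalRing L v) • x) := by rw [hermStar_smul, hσr₁, hxs]
    have hs0 : (1 - e) * ((↑ur⁻¹ : LocalRing L v) • x) ≠ 0 := by
      rw [Matrix.mul_smul]
      exact fun h => hxI ((hur₁.smul_eq_zero).1 h)
    obtain ⟨β, hβZ, β', hβ'Z, hββ', hρ⟩ := hdichZ _ hsZ hss hs0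
    have hρ' : (1 - e) * (x * (hermStar σ Hm β * β)) = r₀ • ((1 - e) * (((↑ur⁻¹ : LocalRing L v) • x) * (hermStar σ Hm β * β))) := by
      rw [Matrix.smul_mul, Matrix.mul_smul, smul_smul, hr₀r₁, one_smul]
    rcases hρ with hρ | hρ
    · -- `x ~ r₀·1`
      obtain ⟨t, htZ, hxt⟩ := hassemble _ zF r₀ β β' (r₀ • (1 : Matrix (Fin 3) (Fin 3) (LocalRing L v))) hβZ hβ'Z hαz hα hββ' (by rw [hρ', hρ, Matrix.mul_smul, Matrix.mul_one])
      refine ⟨t, htZ, Or.inr (Or.inl ?_)⟩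
      rw [hxt, Matrix.mul_smul, Matrix.mul_one, ← smul_add, add_sub_cancel]
    · -- `x ~ r₀·k₀`
      obtain ⟨t, htZ, hxt⟩ := hassemble _ zF r₀ β β' (r₀ • c) hβZ hβ'Z hαz hα hββ' (by rw [hρ', hρ, Matrix.mul_smul])
      refine ⟨t, htZ, Or.inr (Or.inr (Or.inr ?_))⟩
      rw [hxt, hk₀_def, smul_add, smul_smul, mul_one, Matrix.mul_smul]

end TypeTwo

end Summit.HodgeConjecture.HodgeConjecture.R90.S4

end
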